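import Summits.BirchSwinnertonDyer.BirchSwinnertonDyer.Theses.SemiOrdinaryEisensteinDescent
import HarnessLib

/-!
# Route `SemiOrdinaryEisensteinDescent` — glue item `PublishedInputsWildThreeGlue`
# (stmt-BirchSwinnertonDyer-20497): pure logic

The seven by-name children of the support `PublishedInputsWildThree` (stmt-BirchSwinnertonDyer-20389;
the same seven items as route `UniversalToricDescent`'s split of its twin parent) reassemble the
parent: `And.intro` in the item's order — verbatim the proof of the UTD glue
`Theorems.toricPublishedInputsGlue_proof` (item 20429). HONEST FRAMING: pure logic; every leaf stays
a cite-level named fact (Gross–Zagier, Kolyvagin, modularity, …); BSD is not advanced by this.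
Prover seat bsd-wall-bed-p3 (g1), 2026-08-27, on the route author's note (pss3 g4, 14:31:58Z).

References: [GrossZagier1986] Thm. I.(6.3); [Kolyvagin1990] Thm. A.
-/

set_option linter.dupNamespace false

namespace Summit.BirchSwinnertonDyer.BirchSwinnertonDyer.Theorems

open Summit.BirchSwinnertonDyer.BirchSwinnertonDyer.Theses.SemiOrdinaryEisensteinDescent

/-- **Glue `PublishedInputsWildThreeGlue` (item 20497) holds**: `RankEqAnalyticRankLeOne →
EntireLFunctionRat → ModularParametrizationSupply → BSDQuotientIsogenyInvariance →
GrossZagierRationalPointI73 → FriedbergHoffsteinHeegnerSplitDivisorsTwist → ToricParametrisedInputs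
→ PublishedInputsWildThree` by reordering conjuncts. [cite: GrossZagier1986, Thm. I.(6.3)] -/
theorem publishedInputsWildThreeGlue_proof : PublishedInputsWildThreeGlue := by
  unfold PublishedInputsWildThreeGlue
  intro h1 h2 h3 h4 h5 h6 h7
  exact ⟨h7.1, h7.2.1, h1, h2, h3, h4, h5, h6, h7.2.2.1, h7.2.2.2⟩

end Summit.BirchSwinnertonDyer.BirchSwinnertonDyer.Theorems
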